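import Summits.BirchSwinnertonDyer.BirchSwinnertonDyer.Theorems.ByReductionTypeAtTwoAdditiveRankZeroResidualV6
import Summits.BirchSwinnertonDyer.BirchSwinnertonDyer.Theorems.ByReductionTypeAtTwoAdditivePotMultKatoHalfPlusOne
import Summits.BirchSwinnertonDyer.BirchSwinnertonDyer.Theorems.ByReductionTypeAtTwoAdditiveReducibleKatoMemberNST
import HarnessLib

/-!
# Crux `AdditiveRankZeroAtTwo` (K4 item 19098): the crux BY NAME from its one-sided residual, v7 — the over-`K`
# child C4″ `AdditivePotMultOverKAtTwo` (item 22618) NEEDED ONLY on the potentially multiplicative curves with `W^{(−1)}` split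
# multiplicative at `2`, or (`W^{(−2)}` split and (reducible `E[2]` or `ord₂ #Ш_an` odd)), or (reducible `E[2]` failing C2″'s two
# side conditions) (seat `bsd-2adic-addL2x` GEN 13; sequel of v5/v6)

Cell `bsd-2adic`, rung K4, crux stmt-BirchSwinnertonDyer-19098, split v2.2 (children C1″ 22615, C2″ 22616, C3″ 22617,
C4″ 22618, C5‴ 22619, glue 22620). `--supports 19098 --as helper`. HONEST FRAMING (D-0036/D-0054): an assembly-shaped
CONDITIONAL theorem; every research-grade input is displayed; closes nothing at the `∀`-level; nothing booked; BSD is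
not proved by any of this. NO restate of the executed split is asked (record for the planner).

WHAT THIS FILE DOES. GEN 11's glue `additiveRankZeroAtTwo_of_residual_v4` (p627985; file
`…AdditivePotGoodKatoHalf.lean`) sends EVERY potentially multiplicative curve (`ord₂ j < 0`) through lane A's
over-`K` object (binder `hQKm` = child C4″ verbatim). GEN 13's consumer `…AdditivePotMultKatoHalf.lean` of the
reading `Kato2004.rankZero_padicValNat_sha_add_padicValNat_tamagawa_le_at_two_of_noSplitTwistNegOneNegTwo_of_irreducible_of_fineSelmerDual_fg`
(Kato at `2` for ADDITIVE reduction under (NST′) «no split multiplicative twist by `−1` or `−2` at `2`» (APPEND reading)) puts the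
potentially multiplicative (NST′) `E[2]`-IRREDUCIBLE curves into the same one-sided shape as the potentially good
block. v5 = v4 with:
* `hSharp` REPLACED by `hNST2` (the new reading implies the sharp potentially-good reading,
  `katoAtTwoSharp_of_katoAtTwoNST'`), so the potentially-good branch (children C1″ `hAna`, C2″ `hRest`,
  C3″ `hLow` VERBATIM) is v4's §3 unchanged;
* the potentially-multiplicative branch SPLIT: on {(NST′) ∧ `E[2]` irreducible} — `addPotMultNST_bsdp_two_of_conjA_of_lower`
  with the two NEW displayed inputs (I1M) `hAnaM` = statement (A) at `(W,2)` on those curves whose `2`-division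
  field is NOT abelian (the C1″-shaped object on this sub-block) and (I3M) `hLowM` = the lower half over `ℚ` on
  this sub-block (the C3″-shaped object); on the complement — v4's §4 AT THE CURVE
  (`addPotMult_bsdp_two_of_mult_of_overKC_at`) with (I4″′) `hQKm'` = child C4″ RESTRICTED by the extra hypothesis
  `¬ ((NST′) ∧ E[2] irreducible)` (a verbatim weakening of C4″: C4″ ⟹ `hQKm'`).
Inputs: PRINT {`hGZK`, `hmod`, `hmodN`, `hMilneC`, `hHL`, `hLim2`, `hFW`, `hCassels`, `hCT`} + READINGS {`hNST2`
(D-audit owed), `hin` (D-audit PASS hMH2@2)} + sibling {`hMult`} + research `∀`-objects {C1″ `hAna`, C2″ `hRest`,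
C3″ `hLow`, (I1M) `hAnaM`, (I3M) `hLowM`, (I4″′) `hQKm'`}. Census (lane A phi_census, re-read
`pub/bsd-2adic/addL2x/gen13/POTMULT-NST-CENSUS-19098-addL2x-GEN13.tsv`): of the 463 potentially multiplicative
rank-`0` classes, 194 are (NST′) ∧ irreducible (moved off C4″), 269 stay on C4″ (61 (NST′) reducible, 208 with a split
twist by `−1` or `−2`).

* (v5's `addPotMult_bsdp_two_of_mult_of_overKC_at` — v4's §4 at ONE curve — is imported from the v5 file.)
* `additiveRankZeroAtTwo_of_residual_v7` — the crux by name (type = the route decl verbatim). v7 = v6 (p655483) + the REDUCIBLE (NST′)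
  branch through the member door `missingUpperBoundAt_two_of_katoMember_two_NST` (p655998; fact `exists_memberHullInputs_two_of_noSplitTwistNegOneNegTwo`,
  p655907) under C2″'s side conditions, with (I3M_red) `hLowMred` and C4″ restricted further (`hQKm7`). v6 = v5 (p653557) + ONE more
  branch: on {pot-mult, `W^{(−1)}` not split, irreducible, `ord₂ #Ш_an` even} (the `d* = −2`-split classes, 39 on the census) the
  Kato half comes from the `+ 1` reading `hPlus` (p654336) through `addPotMultNST2_upper_two_of_conjA_of_even` (p654471) with inputs
  (I1M₂) `hAnaM2` / (I3M₂) `hLowM2`, and C4″ is restricted further (`hQKm6`); `hQKm6_of_additivePotMultOverKAtTwo`: C4″ ⟹ it.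

References: [Kato2004Asterisque] Thm. 12.5 (3), (12.5.1), 13.13, 14.14; [SilvermanATAEC1994] V.5.3, Ex. 5.11;
[CoatesSujatha2005] statement (A); [Lim2017FineSelmer] Thm. 3.5; [Milne1972ArithmeticAV] Thm. 1; [HoffsteinLuo1997];
[Cassels1965ArithmeticVIII]; [SilvermanAEC2009] X.4.14; [Miller2011LMS] Def. 1.1.
-/

set_option autoImplicit false
set_option linter.dupNamespace false

noncomputable section

open scoped Classical

namespace Summit.BirchSwinnertonDyer.BirchSwinnertonDyer.Theorems.AddKatoTwo

open WeierstrassCurve Literature.NumberTheory.EllipticCurves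
  Literature.NumberTheory.EllipticCurves.ModularForms
  Literature.NumberTheory.EllipticCurves.Kato2004
  Literature.NumberTheory.EllipticCurves.Rank1Residual
  Literature.NumberTheory.EllipticCurves.Rank1Residual.Typed
  Literature.NumberTheory.IwasawaTheory
  Summit.BirchSwinnertonDyer.Rank1Residual Summit.BirchSwinnertonDyer.Rank1Residual.AdditivePotMult
  Summit.BirchSwinnertonDyer.Rank1Residual.X5.AddTwoL2
  Summit.BirchSwinnertonDyer.BirchSwinnertonDyer.Theses.ByReductionTypeAtTwo

/-! ## The crux BY NAME, ONE-SIDED (glue v6) -/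

/-- **The crux `AdditiveRankZeroAtTwo` (item stmt-BirchSwinnertonDyer-19098; type = the route decl verbatim) from its
ONE-SIDED residual, v5.** Inputs: PRINT {`hGZK`, `hmod`, `hmodN`, `hMilneC`, `hHL`, `hLim2`, `hFW`, `hCassels`,
`hCT`} + READINGS {`hNST2` = Kato at `2` for additive reduction under (NST′), `hin` = Kato's member reading} + the
sibling crux `hMult` (`MultiplicativeRankZeroAtTwo`, item 19096) + the research-grade `∀`-objects: C1″ `hAna`
(statement (A) on the potentially good non-abelian-`ℚ(E[2])` curves), C2″ `hRest` (the reducible potentially-good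
rest), C3″ `hLow` (the lower half over `ℚ`, potentially good) — all three VERBATIM the children of the split —,
(I1M) `hAnaM` (statement (A) at `(W,2)` on the potentially MULTIPLICATIVE curves satisfying (NST′) with `E[2]`
irreducible and `ℚ(E[2])` non-abelian), (I3M) `hLowM` (the lower half over `ℚ` on the potentially multiplicative
(NST′) irreducible curves), and (I4″′) `hQKm'` = child C4″ `AdditivePotMultOverKAtTwo` RESTRICTED to the curves NOT in
{(NST′) ∧ irreducible}. Split by the sign of `ord₂ j`; the negative side split again by (NST′) ∧ irreducible. Versus v4
(GEN 11): `hSharp ↦ hNST2` (implies it), C4″ shrinks to its complement sub-block (census: 269 of 463 classes), two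
displayed inputs of the C1″/C3″ shape appear on the other 194. Conditional (audit `proof.conditional`); the item is
NOT closed by this theorem; no restate of the split is asked.
[cite: Kato2004Asterisque, Thm. 12.5 (3) and (12.5.1) (p. 222), 13.13 (p. 233), Thm. 12.6 (p. 222), §14.14 (p. 243), Prop. 14.16 (2) (p. 244)]
[cite: SilvermanATAEC1994, Thm. V.5.3 and Exercise 5.11] [cite: CoatesSujatha2005, statement (A)]
[cite: Lim2017FineSelmer, §3 Thm. 3.5] [cite: Milne1972ArithmeticAV, Thm. 1] [cite: HoffsteinLuo1997, Theorem]
[cite: Cassels1965ArithmeticVIII] [cite: SilvermanAEC2009, Thm. X.4.14] [cite: Miller2011LMS, Def. 1.1] -/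
theorem additiveRankZeroAtTwo_of_residual_v7
    (hGZK : rank_eq_analyticRank_of_analyticRank_le_one) (hmod : hasEntireLFunction_rat) (hmodN : exists_isNewformOf)
    (hMilneC : Milne1972.bsdQuotient_baseChange_quadratic_anyModel)
    (hHL : HoffsteinLuo1997_exists_twist_L_one_ne_zero)
    (hLim2 : Lim2017.thm35_at_two_fineSelmerDual_moduleFinite_of_classicalMuVanishes_of_le_divisionField_four)
    (hFW : ferreroWashington1979_classicalMuVanishes)
    (hCassels : bsdRHS_eq_of_isIsogenous) (hCT : exists_casselsTate_pairing (K := ℚ))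
    (hNST2 : Kato2004.rankZero_padicValNat_sha_add_padicValNat_tamagawa_le_at_two_of_noSplitTwistNegOneNegTwo_of_irreducible_of_fineSelmerDual_fg)
    (hin : Kato2004.exists_memberHullInputs_two)
    (hMult : MultiplicativeRankZeroAtTwo)
    (hAna : ∀ (W : WeierstrassCurve ℚ) [W.IsElliptic] [W.IsGloballyMinimal], ¬ W.HasCM → W.analyticRank = 0 →
      Addv W 2 → 0 ≤ padicValRat 2 W.j → ¬ IsAbelianGalois ℚ (W.divisionField 2) →
      ∀ (κ : ZpExtension ℚ 2), κ.IsCyclotomic →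
        ∃ (γ : Field.absoluteGaloisGroup ℚ) (D : W.FineSelmerDualData κ γ),
          Module.Finite ℤ_[2] (RestrictScalars ℤ_[2] (IwasawaAlgebra 2) D.X))
    (hRest : ∀ (W : WeierstrassCurve ℚ) [W.IsElliptic] [W.IsGloballyMinimal], ¬ W.HasCM → W.analyticRank = 0 →
      Addv W 2 → 0 ≤ padicValRat 2 W.j → ¬ W.HasIrreducibleModPGaloisRep 2 →
      ¬ ((∀ (W' : WeierstrassCurve ℚ) [W'.IsElliptic], IsIsogenous W W' → ¬ 2 ^ 2 ∣ W'.torsionOrder) ∧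
          (∀ q : ℚ, shaAn W = (q : ℂ) → Even (padicValRat 2 q))) →
      MissingUpperBoundAt W 2)
    (hLow : ∀ (W : WeierstrassCurve ℚ) [W.IsElliptic] [W.IsGloballyMinimal], ¬ W.HasCM → W.analyticRank = 0 →
      Addv W 2 → 0 ≤ padicValRat 2 W.j → MissingLowerBoundAt W 2)
    (hAnaM : ∀ (W : WeierstrassCurve ℚ) [W.IsElliptic] [W.IsGloballyMinimal], ¬ W.HasCM → W.analyticRank = 0 →
      Addv W 2 → padicValRat 2 W.j < 0 →
      (∀ d : ℚ, d = -1 ∨ d = -2 → ¬ (W.quadraticTwist d).HasSplitMultiplicativeReductionAtPrime 2) →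
      W.HasIrreducibleModPGaloisRep 2 → ¬ IsAbelianGalois ℚ (W.divisionField 2) →
      ∀ (κ : ZpExtension ℚ 2), κ.IsCyclotomic →
        ∃ (γ : Field.absoluteGaloisGroup ℚ) (D : W.FineSelmerDualData κ γ),
          Module.Finite ℤ_[2] (RestrictScalars ℤ_[2] (IwasawaAlgebra 2) D.X))
    (hLowM : ∀ (W : WeierstrassCurve ℚ) [W.IsElliptic] [W.IsGloballyMinimal], ¬ W.HasCM → W.analyticRank = 0 →
      Addv W 2 → padicValRat 2 W.j < 0 →
      (∀ d : ℚ, d = -1 ∨ d = -2 → ¬ (W.quadraticTwist d).HasSplitMultiplicativeReductionAtPrime 2) →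
      W.HasIrreducibleModPGaloisRep 2 → MissingLowerBoundAt W 2)
    (hPlus : Kato2004.rankZero_padicValNat_sha_add_padicValNat_tamagawa_le_add_one_at_two_of_noSplitTwistNegOne_of_irreducible_of_fineSelmerDual_fg)
    (hAnaM2 : ∀ (W : WeierstrassCurve ℚ) [W.IsElliptic] [W.IsGloballyMinimal], ¬ W.HasCM → W.analyticRank = 0 →
      Addv W 2 → padicValRat 2 W.j < 0 → ¬ (W.quadraticTwist (-1)).HasSplitMultiplicativeReductionAtPrime 2 →
      W.HasIrreducibleModPGaloisRep 2 → ¬ IsAbelianGalois ℚ (W.divisionField 2) →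
      ∀ (κ : ZpExtension ℚ 2), κ.IsCyclotomic →
        ∃ (γ : Field.absoluteGaloisGroup ℚ) (D : W.FineSelmerDualData κ γ),
          Module.Finite ℤ_[2] (RestrictScalars ℤ_[2] (IwasawaAlgebra 2) D.X))
    (hLowM2 : ∀ (W : WeierstrassCurve ℚ) [W.IsElliptic] [W.IsGloballyMinimal], ¬ W.HasCM → W.analyticRank = 0 →
      Addv W 2 → padicValRat 2 W.j < 0 → ¬ (W.quadraticTwist (-1)).HasSplitMultiplicativeReductionAtPrime 2 →
      W.HasIrreducibleModPGaloisRep 2 → (∀ q : ℚ, shaAn W = (q : ℂ) → Even (padicValRat 2 q)) → MissingLowerBoundAt W 2)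
    (hinNST : Kato2004.exists_memberHullInputs_two_of_noSplitTwistNegOneNegTwo)
    (hLowMred : ∀ (W : WeierstrassCurve ℚ) [W.IsElliptic] [W.IsGloballyMinimal], ¬ W.HasCM → W.analyticRank = 0 →
      Addv W 2 → padicValRat 2 W.j < 0 →
      (∀ d : ℚ, d = -1 ∨ d = -2 → ¬ (W.quadraticTwist d).HasSplitMultiplicativeReductionAtPrime 2) →
      ¬ W.HasIrreducibleModPGaloisRep 2 →
      ((∀ (W' : WeierstrassCurve ℚ) [W'.IsElliptic], IsIsogenous W W' → ¬ 2 ^ 2 ∣ W'.torsionOrder) ∧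
          (∀ q : ℚ, shaAn W = (q : ℂ) → Even (padicValRat 2 q))) → MissingLowerBoundAt W 2)
    (hQKm7 : ∀ (W : WeierstrassCurve ℚ) [W.IsElliptic] [W.IsGloballyMinimal], ¬ W.HasCM → W.analyticRank = 0 →
      Addv W 2 → padicValRat 2 W.j < 0 →
      ¬ ((∀ d : ℚ, d = -1 ∨ d = -2 → ¬ (W.quadraticTwist d).HasSplitMultiplicativeReductionAtPrime 2) ∧
          W.HasIrreducibleModPGaloisRep 2) →
      ¬ (¬ (W.quadraticTwist (-1)).HasSplitMultiplicativeReductionAtPrime 2 ∧ W.HasIrreducibleModPGaloisRep 2 ∧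
          (∀ q : ℚ, shaAn W = (q : ℂ) → Even (padicValRat 2 q))) →
      ¬ ((∀ d : ℚ, d = -1 ∨ d = -2 → ¬ (W.quadraticTwist d).HasSplitMultiplicativeReductionAtPrime 2) ∧
          ¬ W.HasIrreducibleModPGaloisRep 2 ∧
          ((∀ (W' : WeierstrassCurve ℚ) [W'.IsElliptic], IsIsogenous W W' → ¬ 2 ^ 2 ∣ W'.torsionOrder) ∧
            (∀ q : ℚ, shaAn W = (q : ℂ) → Even (padicValRat 2 q)))) →
      ∀ (K : Type) [Field K] [NumberField K], Module.finrank ℚ K = 2 →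
        SemistableTwistAtTwo W K → (W.quadraticTwist (NumberField.discr K : ℚ)).entireLFunction 1 ≠ 0 →
          MissingPPartOverCAt (W.baseChange K) 2) :
    Summit.BirchSwinnertonDyer.BirchSwinnertonDyer.Theses.ByReductionTypeAtTwo.AdditiveRankZeroAtTwo := by
  unfold Summit.BirchSwinnertonDyer.BirchSwinnertonDyer.Theses.ByReductionTypeAtTwo.AdditiveRankZeroAtTwo
  intro W _ _ hcm hr hadd
  haveI : Fact (Nat.Prime 2) := ⟨Nat.prime_two⟩
  by_cases hj : 0 ≤ padicValRat 2 W.j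
  · exact addPotGood_bsdp_two_of_kato_of_lower hGZK hmod hmodN hLim2 hFW hCassels hCT
      (katoAtTwoSharp_of_katoAtTwoNST' hNST2) hin hAna hRest hLow W hcm hr hadd hj
  · have hj' : padicValRat 2 W.j < 0 := lt_of_not_ge hj
    by_cases hsub : (∀ d : ℚ, d = -1 ∨ d = -2 →
        ¬ (W.quadraticTwist d).HasSplitMultiplicativeReductionAtPrime 2) ∧ W.HasIrreducibleModPGaloisRep 2
    · exact addPotMultNST_bsdp_two_of_conjA_of_lower hNST2 hGZK hmod hLim2 hFW hAnaM hLowM W hcm hr hadd hj'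
        hsub.1 hsub.2
    · by_cases hsub2 : ¬ (W.quadraticTwist (-1)).HasSplitMultiplicativeReductionAtPrime 2 ∧
          W.HasIrreducibleModPGaloisRep 2 ∧ (∀ q : ℚ, shaAn W = (q : ℂ) → Even (padicValRat 2 q))
      · have hr1 : W.analyticRank ≤ 1 := by rw [hr]; exact zero_le_one
        exact bsdp_of_missingPPartAt W 2 hGZK hr1
          (missingPPartAt_of_lower_of_upper W 2 (hLowM2 W hcm hr hadd hj' hsub2.1 hsub2.2.1 hsub2.2.2)
            (addPotMultNST2_upper_two_of_conjA_of_even hPlus hGZK hmod hCT hLim2 hFW hAnaM2 W hcm hr hadd hj'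
              hsub2.1 hsub2.2.1 hsub2.2.2))
      · by_cases hsub3 : (∀ d : ℚ, d = -1 ∨ d = -2 →
            ¬ (W.quadraticTwist d).HasSplitMultiplicativeReductionAtPrime 2) ∧ ¬ W.HasIrreducibleModPGaloisRep 2 ∧
            ((∀ (W' : WeierstrassCurve ℚ) [W'.IsElliptic], IsIsogenous W W' → ¬ 2 ^ 2 ∣ W'.torsionOrder) ∧
              (∀ q : ℚ, shaAn W = (q : ℂ) → Even (padicValRat 2 q)))
        · have hr1 : W.analyticRank ≤ 1 := by rw [hr]; exact zero_le_one
          exact bsdp_of_missingPPartAt W 2 hGZK hr1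
            (missingPPartAt_of_lower_of_upper W 2 (hLowMred W hcm hr hadd hj' hsub3.1 hsub3.2.1 hsub3.2.2)
              (missingUpperBoundAt_two_of_katoMember_two_NST hmodN hinNST hLim2 hFW hCassels hCT hGZK hmod W hcm hadd.1
                hadd.2 hsub3.1 hsub3.2.1 hr hsub3.2.2.1 hsub3.2.2.2))
        · exact addPotMult_bsdp_two_of_mult_of_overKC_at hGZK hmod hMilneC hHL hMult W hcm hr hadd hj'
            (hQKm7 W hcm hr hadd hj' hsub hsub2 hsub3)

/-- **C4″ ⟹ its restriction (I4″′)**: the executed child `AdditivePotMultOverKAtTwo` (item 22618) implies the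
restricted binder `hQKm'` of v5 — the extra hypothesis is simply dropped. So v5 is fed by the five children of split
v2.2 plus (I1M), (I3M); bookkeeping. [cite: Miller2011LMS, Def. 1.1] -/
theorem hQKm7_of_additivePotMultOverKAtTwo (h : AdditivePotMultOverKAtTwo) :
    ∀ (W : WeierstrassCurve ℚ) [W.IsElliptic] [W.IsGloballyMinimal], ¬ W.HasCM → W.analyticRank = 0 →
      Addv W 2 → padicValRat 2 W.j < 0 →
      ¬ ((∀ d : ℚ, d = -1 ∨ d = -2 → ¬ (W.quadraticTwist d).HasSplitMultiplicativeReductionAtPrime 2) ∧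
          W.HasIrreducibleModPGaloisRep 2) →
      ¬ (¬ (W.quadraticTwist (-1)).HasSplitMultiplicativeReductionAtPrime 2 ∧ W.HasIrreducibleModPGaloisRep 2 ∧
          (∀ q : ℚ, shaAn W = (q : ℂ) → Even (padicValRat 2 q))) →
      ¬ ((∀ d : ℚ, d = -1 ∨ d = -2 → ¬ (W.quadraticTwist d).HasSplitMultiplicativeReductionAtPrime 2) ∧
          ¬ W.HasIrreducibleModPGaloisRep 2 ∧
          ((∀ (W' : WeierstrassCurve ℚ) [W'.IsElliptic], IsIsogenous W W' → ¬ 2 ^ 2 ∣ W'.torsionOrder) ∧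
            (∀ q : ℚ, shaAn W = (q : ℂ) → Even (padicValRat 2 q)))) →
      ∀ (K : Type) [Field K] [NumberField K], Module.finrank ℚ K = 2 →
        SemistableTwistAtTwo W K → (W.quadraticTwist (NumberField.discr K : ℚ)).entireLFunction 1 ≠ 0 →
          MissingPPartOverCAt (W.baseChange K) 2 := by
  intro W _ _ hcm hr hadd hj _ _ _ K _ _ h2 hst hL
  exact h W hcm hr hadd hj K h2 hst hL

end Summit.BirchSwinnertonDyer.BirchSwinnertonDyer.Theorems.AddKatoTwo

end
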